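import Mathlib
import HarnessLib
import Literature.MathematicalPhysics.StatisticalMechanics.RenormalisationMap
import Literature.Probability.Distributions.GaussianLinearCompensation

/-!
# The renormalisation-group representation of the partition function: iterating the step
# identity through all scales ([ABKM19] (4.9)–(4.12))

With the finite-range decomposition `𝒞^{(q)} = Σ_{k=1}^{N+1} 𝒞_k` the Gaussian measure factorises as
`μ^{(q)} = μ_1 ∗ μ_2 ∗ ⋯ ∗ μ_{N+1}`, `μ_k = N(0, circulant 𝒞_k)`, and the partition functional
`𝒵 = ∫ F_0 dμ^{(q)}` becomes an `(N+1)`-fold integral ((4.9)–(4.10)).  If the renormalisation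
transformation produces functionals with `F_{k+1}(φ) = ∫ F_k(φ + ξ) μ_{k+1}(dξ)` — Proposition 6.6,
`RenormalisationMap.rgStep_identity`, for `F_k = (e^{−H_k} ∘_k K_k)(Λ)` — then
`𝒵 = ∫ F_N dμ_{N+1}` ((4.12)).  This file proves the convolution bookkeeping:

* `stepMeasure_add` — `N(0, circulant(𝒞₁ + 𝒞₂)) = N(0, circulant 𝒞₁) ∗ N(0, circulant 𝒞₂)`;
* `integral_conv_eq` — `∫ F d(μ ∗ ν) = ∫ (∫ F(φ + ξ) dμ(ξ)) dν(φ)` (Fubini);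
* `tailKernel 𝒞 N m = Σ_{j = N+1−m}^{N+1} 𝒞_j`, `tailMeasure` — the measure of the last `m+1` steps;
* **`integral_flow_eq`** — if `F_{k+1}(φ) = ∫ F_k(φ + ξ) μ_{k+1}(dξ)` for `k < N` (with the Fubini
  integrability at every step), then `∫ F_0 d(μ_1 ∗ ⋯ ∗ μ_{N+1}) = ∫ F_N dμ_{N+1}`;
* (appended) the last scale (4.12): `pcirc_expNegH_last_scale` (`(K∘e^{−H})(Λ) = e^{−H(Λ)} + K(Λ)`),
  `integral_last_scale`, `integral_last_scale_zero` (`= 1 + ∫ K_N(Λ) dμ_{N+1}` when `H_N = 0`).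

Everything is proved; no named fact.  The integrability hypotheses are discharged in the
application by the norm estimates of Ch. 9–10.

## References
* S. Adams, S. Buchholz, R. Kotecký, S. Müller, arXiv:1910.13564, Ch. 4.2 (4.9)–(4.12)
  [AdamsBuchholzKoteckyMuller2019].
-/

noncomputable section

namespace Literature.MathematicalPhysics.StatisticalMechanics.GradientRG

open scoped BigOperators Classical
open Finset MeasureTheory ProbabilityTheory
open Literature.Probability.Distributions (matrixCLM multivariateGaussian_conv ofLp_matrixCLM)

variable {d M : ℕ} [NeZero M]

/-! ## The step measures convolve -/

/-- `ofLp` as an additive monoid homomorphism on field space. [folklore] -/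
private def ofLpAddHom : EuclideanSpace ℝ (Fin d → ZMod M) →+ ((Fin d → ZMod M) → ℝ) where
  toFun := WithLp.ofLp
  map_zero' := rfl
  map_add' _ _ := rfl

/-- **`μ_{𝒞₁ + 𝒞₂} = μ_{𝒞₁} ∗ μ_{𝒞₂}`** for positive semidefinite circulant kernels (independent
Gaussian increments add their covariances). [cite: AdamsBuchholzKoteckyMuller2019, Ch. 4.2 (4.9)–(4.10)] -/
theorem stepMeasure_add {𝒞₁ 𝒞₂ : (Fin d → ZMod M) → ℝ} (h₁ : (Matrix.circulant 𝒞₁).PosSemidef)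
    (h₂ : (Matrix.circulant 𝒞₂).PosSemidef) :
    stepMeasure (𝒞₁ + 𝒞₂) = stepMeasure 𝒞₁ ∗ stepMeasure 𝒞₂ := by
  have h := Measure.map_conv_addMonoidHom (μ := multivariateGaussian 0 (Matrix.circulant 𝒞₁))
    (ν := multivariateGaussian 0 (Matrix.circulant 𝒞₂)) (ofLpAddHom (d := d) (M := M))
    (PiLp.continuous_ofLp 2 _).measurable
  rw [multivariateGaussian_conv h₁ h₂, ← Matrix.circulant_add] at h
  exact h

/-! ## Fubini for a convolution -/

omit [NeZero M] in
/-- **`∫ F d(μ ∗ ν) = ∫ (∫ F(φ + ξ) dμ(ξ)) dν(φ)`** for `F(ξ + φ)` integrable on the product.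
[cite: AdamsBuchholzKoteckyMuller2019, Ch. 4.2 (4.10)] -/
theorem integral_conv_eq {μ ν : Measure ((Fin d → ZMod M) → ℝ)} [SFinite μ] [SFinite ν]
    {F : ((Fin d → ZMod M) → ℝ) → ℂ} (hF : AEStronglyMeasurable F (μ ∗ ν))
    (hint : Integrable (fun p : ((Fin d → ZMod M) → ℝ) × ((Fin d → ZMod M) → ℝ) => F (p.1 + p.2)) (μ.prod ν)) :
    ∫ x, F x ∂(μ ∗ ν) = ∫ φ, ∫ ξ, F (φ + ξ) ∂μ ∂ν := by
  rw [Measure.conv, integral_map (by fun_prop) (by rwa [Measure.conv] at hF), integral_prod_symm _ hint]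
  exact integral_congr_ae (Filter.Eventually.of_forall fun φ =>
    integral_congr_ae (Filter.Eventually.of_forall fun ξ => by simp only [add_comm]))

/-! ## The tail measures and the iterated identity -/

/-- The kernel of the last `m + 1` steps: `Σ_{j = N+1−m}^{N+1} 𝒞_j`.
[cite: AdamsBuchholzKoteckyMuller2019, Ch. 4.2 (4.9)] -/
def tailKernel (𝒞 : ℕ → (Fin d → ZMod M) → ℝ) (N : ℕ) : ℕ → (Fin d → ZMod M) → ℝ
  | 0 => 𝒞 (N + 1)
  | m + 1 => 𝒞 (N - m) + tailKernel 𝒞 N m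

/-- The measure of the last `m + 1` steps, `μ_{N+1−m} ∗ ⋯ ∗ μ_{N+1}` as a single Gaussian.
[cite: AdamsBuchholzKoteckyMuller2019, Ch. 4.2 (4.9)] -/
def tailMeasure (𝒞 : ℕ → (Fin d → ZMod M) → ℝ) (N m : ℕ) : Measure ((Fin d → ZMod M) → ℝ) :=
  stepMeasure (tailKernel 𝒞 N m)

omit [NeZero M] in
/-- The tail kernels are positive semidefinite when the steps are. [cite: AdamsBuchholzKoteckyMuller2019, Ch. 4.2] -/
theorem posSemidef_tailKernel {𝒞 : ℕ → (Fin d → ZMod M) → ℝ} {N : ℕ}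
    (h𝒞 : ∀ j, 1 ≤ j → j ≤ N + 1 → (Matrix.circulant (𝒞 j)).PosSemidef) :
    ∀ m, m ≤ N → (Matrix.circulant (tailKernel 𝒞 N m)).PosSemidef := by
  intro m
  induction m with
  | zero => intro _; exact h𝒞 (N + 1) (by omega) le_rfl
  | succ m ih =>
    intro hm
    rw [tailKernel, Matrix.circulant_add]
    exact (h𝒞 (N - m) (by omega) (by omega)).add (ih (by omega))

/-- **One more step**: `μ_{N−m} ∗ (tail of m+1 steps) = tail of m+2 steps`.
[cite: AdamsBuchholzKoteckyMuller2019, Ch. 4.2 (4.9)] -/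
theorem tailMeasure_succ {𝒞 : ℕ → (Fin d → ZMod M) → ℝ} {N : ℕ}
    (h𝒞 : ∀ j, 1 ≤ j → j ≤ N + 1 → (Matrix.circulant (𝒞 j)).PosSemidef) {m : ℕ} (hm : m + 1 ≤ N) :
    tailMeasure 𝒞 N (m + 1) = stepMeasure (𝒞 (N - m)) ∗ tailMeasure 𝒞 N m := by
  rw [tailMeasure, tailKernel, stepMeasure_add (h𝒞 (N - m) (by omega) (by omega))
    (posSemidef_tailKernel h𝒞 m (by omega)), tailMeasure]

/-- **The iterated identity (4.11)–(4.12)**: if `F_{k+1}(φ) = ∫ F_k(φ + ξ) μ_{k+1}(dξ)` for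
`k < N` (each with the product integrability that Fubini needs), then
`∫ F_0 d(μ_1 ∗ ⋯ ∗ μ_{N+1}) = ∫ F_N dμ_{N+1}`. [cite: AdamsBuchholzKoteckyMuller2019, Ch. 4.2 (4.11)–(4.12)] -/
theorem integral_flow_eq {𝒞 : ℕ → (Fin d → ZMod M) → ℝ} {N : ℕ}
    (h𝒞 : ∀ j, 1 ≤ j → j ≤ N + 1 → (Matrix.circulant (𝒞 j)).PosSemidef)
    {F : ℕ → ((Fin d → ZMod M) → ℝ) → ℂ} (hmeas : ∀ k, k ≤ N → Measurable (F k))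
    (hstep : ∀ k, k < N → ∀ φ, ∫ ξ, F k (φ + ξ) ∂(stepMeasure (𝒞 (k + 1))) = F (k + 1) φ)
    (hint : ∀ k, k < N → Integrable (fun p : ((Fin d → ZMod M) → ℝ) × ((Fin d → ZMod M) → ℝ) =>
      F k (p.1 + p.2)) ((stepMeasure (𝒞 (k + 1))).prod (tailMeasure 𝒞 N (N - (k + 1))))) :
    ∫ φ, F 0 φ ∂(tailMeasure 𝒞 N N) = ∫ φ, F N φ ∂(tailMeasure 𝒞 N 0) := by
  -- downward induction: `∫ F_{N−m} d(tail m) = ∫ F_N d(tail 0)` for all `m ≤ N`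
  suffices H : ∀ m, m ≤ N → ∫ φ, F (N - m) φ ∂(tailMeasure 𝒞 N m) = ∫ φ, F N φ ∂(tailMeasure 𝒞 N 0) by
    have := H N le_rfl
    rwa [Nat.sub_self] at this
  intro m
  induction m with
  | zero => intro _; rw [Nat.sub_zero]
  | succ m ih =>
    intro hm
    have hk : N - (m + 1) < N := by omega
    have hk1 : N - (m + 1) + 1 = N - m := by omega
    haveI hS1 : SFinite (stepMeasure (M := M) (𝒞 (N - m))) := by unfold stepMeasure; infer_instance
    haveI hS2 : SFinite (tailMeasure 𝒞 N m) := by unfold tailMeasure stepMeasure; infer_instance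
    rw [tailMeasure_succ h𝒞 (by omega)]
    have hint' := hint (N - (m + 1)) hk
    rw [hk1, show N - (N - m) = m by omega] at hint'
    rw [integral_conv_eq ((hmeas _ (by omega)).aestronglyMeasurable) hint']
    have hstep' := hstep (N - (m + 1)) hk
    rw [hk1] at hstep'
    simp_rw [hstep']
    exact ih (by omega)

/-! ## The last scale ((4.12)): `(e^{−H_N} ∘_N K_N)(Λ) = e^{−H_N(Λ)} + K_N(Λ)` -/

/-- **At the last scale the circle product has two terms**: on the odd torus of side `M = L^N`
(one `N`-block, the only `N`-polymers are `∅` and `Λ`), for `K(∅) = 1`,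
`(K ∘_N e^{−H})(Λ, φ) = e^{−H(Λ, φ)} + K(Λ, φ)` — the integrand of (4.12).
[cite: AdamsBuchholzKoteckyMuller2019, Ch. 4.3 ((4.12): e^{−H_N} ∘ K_N(Λ) = e^{−H_N(Λ)} + K_N(Λ))] -/
theorem pcirc_expNegH_last_scale (hM : Odd M) (hne : (Finset.univ : Finset (Fin d → ZMod M)) ≠ ∅)
    (H : RelevantHamiltonian ℂ d) {K : Finset (Fin d → ZMod M) → ((Fin d → ZMod M) → ℝ) → ℂ}
    (φ : (Fin d → ZMod M) → ℝ) (hK : K ∅ φ = 1) :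
    TorusPolymer.pcirc M (fun U => K U φ) (fun V => expNegH H V φ) Finset.univ =
      expNegH H Finset.univ φ + K Finset.univ φ := by
  rw [TorusPolymer.pcirc_univ_last hM hne, hK, one_mul]
  simp [expNegH]

/-- **The representation (4.12) at the last scale**: if `K_N(∅) = 1` then
`∫ (K_N ∘_N e^{−H_N})(Λ) dμ_{N+1} = ∫ (e^{−H_N(Λ, φ)} + K_N(Λ, φ)) μ_{N+1}(dφ)`; with the tuning
`H_N = 0` of Ch. 12 this is `1 + ∫ K_N(Λ) dμ_{N+1}`.
[cite: AdamsBuchholzKoteckyMuller2019, Ch. 4.3 (4.12), Ch. 4.4] -/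
theorem integral_last_scale (hM : Odd M) (hne : (Finset.univ : Finset (Fin d → ZMod M)) ≠ ∅)
    (μ : Measure ((Fin d → ZMod M) → ℝ)) (H : RelevantHamiltonian ℂ d)
    {K : Finset (Fin d → ZMod M) → ((Fin d → ZMod M) → ℝ) → ℂ} (hK : ∀ φ, K ∅ φ = 1) :
    ∫ φ, TorusPolymer.pcirc M (fun U => K U φ) (fun V => expNegH H V φ) Finset.univ ∂μ =
      ∫ φ, (expNegH H Finset.univ φ + K Finset.univ φ) ∂μ :=
  integral_congr_ae (Filter.Eventually.of_forall fun φ => pcirc_expNegH_last_scale hM hne H φ (hK φ))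

/-- With `H_N = 0` and a probability measure: `∫ (K_N ∘_N 1)(Λ) dμ_{N+1} = 1 + ∫ K_N(Λ) dμ_{N+1}`
(the form to which `ne_zero_of_representation`-type closing arguments apply).
[cite: AdamsBuchholzKoteckyMuller2019, Ch. 4.4 (𝒵 = ∫ (1 + K_N) dμ)] -/
theorem integral_last_scale_zero (hM : Odd M) (hne : (Finset.univ : Finset (Fin d → ZMod M)) ≠ ∅)
    (μ : Measure ((Fin d → ZMod M) → ℝ)) [IsProbabilityMeasure μ]
    {K : Finset (Fin d → ZMod M) → ((Fin d → ZMod M) → ℝ) → ℂ} (hK : ∀ φ, K ∅ φ = 1)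
    (hint : Integrable (fun φ => K Finset.univ φ) μ) :
    ∫ φ, TorusPolymer.pcirc M (fun U => K U φ) (fun V => expNegH (0 : RelevantHamiltonian ℂ d) V φ)
        Finset.univ ∂μ = 1 + ∫ φ, K Finset.univ φ ∂μ := by
  rw [integral_last_scale hM hne μ 0 hK]
  simp only [expNegH, eval_zero, neg_zero, Complex.exp_zero]
  rw [integral_add (integrable_const _) hint, integral_const, probReal_univ, one_smul]

end Literature.MathematicalPhysics.StatisticalMechanics.GradientRG

end
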